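import Mathlib.Tactic
import Literature.Barriers.CriticalPhenomena.RigorousRGSmallParameterHHWThm22CertTail
import HarnessLib

/-!
# Hara–Hattori–Watanabe 2001, Theorem 2.2: certificate soundness, part 3 (the `T` step and one RG step)

Third theorem-only file on the meaning of `Thm22Cert.Cfg.check` (Proposition 5.1 of
Hara–Hattori–Watanabe, CMP 220 (2001), §5.2). The `T` step against the checker: the computed ratio
dominates the real one, the checker's tail terms dominate the majorants of (5.26)–(5.27),
`aLo n ≤ ã_n O` ((5.10)) and `ã_n O ≤ aHiCore n + tail n` ((5.11) with (5.25)–(5.29)),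
`ã_n = Σ_m (β/2)^m b_{m+n} tildeCoef m n` being summable ((5.6), in the order of
`taylorA_traj_succ`); then the normalisation `a_{n,N+1} = ã_n/ã_0` ((5.7), (5.12)):
**`step_sound`** — if a state encloses a sequence with `a_0 = 1`, `a_n ≥ 0`, (A.6) and its flag
holds, the next state encloses `a'_n = ã_n(a)/ã_0(a)`. Theorems only (`O = 2^P`).
-/

noncomputable section

namespace Literature.Barriers.CriticalPhenomena.HierarchicalRG.Thm22Cert

open Finset

namespace Cfg

variable {C : Cfg}
variable {lo hi : List ℕ} {a : ℕ → ℝ}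

/-! ### The `T` step: truncated sums and the tail -/

/-- The flag of `tail` is the ratio test `qn < qd`. [folklore] -/
theorem tail_snd_eq (T : Tab) (hp : List ℕ) (hiM h n : ℕ) :
    (C.tail T hp hiM h n).2 = decide ((if n = 0 then 2 * (3 * C.M + 1 + 1) else 2 * (3 * C.M + 1) + 2 * n + 1) *
      C.rH * h < (3 * C.M + 1 + 1) * 2 * C.one * C.one) := rfl

/-- The value of `tail`: explicit majorants plus the geometric remainder. [folklore] -/
theorem tail_fst_eq (T : Tab) (hp : List ℕ) (hiM h n : ℕ) :
    (C.tail T hp hiM h n).1 = nsum (fun j => C.termU T hp hiM n (2 * C.M + 1 - n + j))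
        (3 * C.M + 1 - (2 * C.M + 1 - n)) +
      cdiv (C.termU T hp hiM n (3 * C.M + 1) * ((3 * C.M + 1 + 1) * 2 * C.one * C.one))
        ((3 * C.M + 1 + 1) * 2 * C.one * C.one -
          (if n = 0 then 2 * (3 * C.M + 1 + 1) else 2 * (3 * C.M + 1) + 2 * n + 1) * C.rH * h) := rfl

/-- The ratio bound computed by the checker dominates the real one: with `h ≥ a_1 2^P`,
`ρ(n,m₁) βc a_1/2 ≤ qn/qd`. [cite: HaraHattoriWatanabe2001, §5.2 eq. (5.28)] -/
theorem ratio_le_checker (hs : C.sqrtOK = true) (hnn : ∀ n, 0 ≤ a n) {h : ℕ} (hh : a 1 * C.one ≤ h)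
    (n m1 : ℕ) :
    (if n = 0 then (2 : ℝ) else ((2 * n + 2 * m1 + 1 : ℝ) / (m1 + 1))) * (beta (Real.sqrt 2) * Real.sqrt 2 * a 1 / 2) ≤
      (((if n = 0 then 2 * (m1 + 1) else 2 * m1 + 2 * n + 1) * C.rH * h : ℕ) : ℝ) /
        (((m1 + 1) * 2 * C.one * C.one : ℕ) : ℝ) := by
  have hO := C.one_pos
  have hβ := beta_sqrt_two_pos
  have hr := C.rH_sound hs
  have h1 : 0 ≤ a 1 := hnn 1
  have hprod : beta (Real.sqrt 2) * Real.sqrt 2 * a 1 * (C.one * C.one) ≤ (C.rH : ℝ) * h := by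
    calc beta (Real.sqrt 2) * Real.sqrt 2 * a 1 * (C.one * C.one) = (beta (Real.sqrt 2) * Real.sqrt 2 * C.one) * (a 1 * C.one) := by
          ring
      _ ≤ (C.rH : ℝ) * h := mul_le_mul hr hh (mul_nonneg h1 hO.le) (by positivity)
  have hqd : (0 : ℝ) < (((m1 + 1) * 2 * C.one * C.one : ℕ) : ℝ) := by push_cast; positivity
  rw [le_div_iff₀ hqd]
  split_ifs with hn
  · push_cast
    nlinarith
  · push_cast
    have hm : (0 : ℝ) < m1 + 1 := by positivity
    calc (2 * n + 2 * m1 + 1 : ℝ) / (m1 + 1) * (beta (Real.sqrt 2) * Real.sqrt 2 * a 1 / 2) * ((m1 + 1) * 2 * C.one * C.one)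
        = (2 * m1 + 2 * n + 1) * (beta (Real.sqrt 2) * Real.sqrt 2 * a 1 * (C.one * C.one)) := by
          field_simp; ring
      _ ≤ (2 * m1 + 2 * n + 1) * ((C.rH : ℝ) * h) := mul_le_mul_of_nonneg_left hprod (by positivity)
      _ = (2 * m1 + 2 * n + 1) * C.rH * h := by ring

/-- The checker's tail term dominates the majorant: `U_m 2^P ≤ termU n m` for `m₀ ≤ m ≤ m₁`
(`m₀ = 2M+1-n`, `m₁ = 3M+1`), given `hp = powsH h (3M+1) 2^P` with `h ≥ a_1 2^P` and `hiM ≥ a_M 2^P`.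
[cite: HaraHattoriWatanabe2001, §5.2 eqs. (5.26)–(5.27)] -/
theorem U_le_termU (hs : C.sqrtOK = true) (hnn : ∀ n, 0 ≤ a n) {h hiM : ℕ} (hh : a 1 * C.one ≤ h)
    (hhiM : a C.M * C.one ≤ hiM) {n m : ℕ} (hn : n ≤ C.M) (hm0 : 2 * C.M + 1 - n ≤ m) (hm1 : m ≤ 3 * C.M + 1) :
    (tildeCoef m n * (beta (Real.sqrt 2) / 2) ^ m * (Real.sqrt 2 / 2) ^ (m + n) * (a C.M * a 1 ^ (m + n - C.M))) * C.one ≤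
      (C.termU C.mkTab (C.powsH h (3 * C.M + 1) C.one) hiM n m : ℝ) := by
  have hO := C.one_pos
  have hβ := beta_sqrt_two_pos
  have h0 := hnn
  unfold termU
  rw [C.mkTab_twH (by omega) (by omega), show 2 * C.M + 1 - n + (m - (2 * C.M + 1 - n)) = m by omega]
  have htw := C.twH_sound hs n m
  have hp := C.powsH_sound (h0 1) hh (3 * C.M + 1) (x := C.one) (u := 1) zero_le_one (by simp)
    (m + n - C.M) (by omega)
  rw [one_mul] at hp
  have step1 := C.mulH_ge (u := tildeCoef m n * (beta (Real.sqrt 2) / 2) ^ m * (Real.sqrt 2 / 2) ^ (m + n))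
    (v := a 1 ^ (m + n - C.M)) (by have := tildeCoef_nonneg m n; positivity) (pow_nonneg (h0 1) _) htw hp
  have step2 := C.mulH_ge (u := tildeCoef m n * (beta (Real.sqrt 2) / 2) ^ m * (Real.sqrt 2 / 2) ^ (m + n) * a 1 ^ (m + n - C.M))
    (v := a C.M) (by have := tildeCoef_nonneg m n; have := h0 1; positivity) (h0 _) step1 hhiM
  calc (tildeCoef m n * (beta (Real.sqrt 2) / 2) ^ m * (Real.sqrt 2 / 2) ^ (m + n) * (a C.M * a 1 ^ (m + n - C.M))) * C.one
      = tildeCoef m n * (beta (Real.sqrt 2) / 2) ^ m * (Real.sqrt 2 / 2) ^ (m + n) * a 1 ^ (m + n - C.M) * a C.M * C.one := by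
        ring
    _ ≤ _ := step2

/-- **Lower `T` bound**: `aLo n ≤ ã_n 2^P` (`n ≤ M`), given the `S` enclosures and summability.
[cite: HaraHattoriWatanabe2001, §5.2 eq. (5.10) and Proposition 5.1] -/
theorem aLo_le (hs : C.sqrtOK = true) (hE : C.Encl lo hi a) (hnn : ∀ n, 0 ≤ a n) {n : ℕ} (hn : n ≤ C.M)
    (hsum : Summable (fun m => ((beta (Real.sqrt 2) / 2) ^ m * bOf a (m + n) * tildeCoef m n))) :
    (C.aLo C.mkTab ((List.range (2 * C.M + 1)).map (C.bLo C.mkTab lo)) n : ℝ) ≤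
      (∑' m, ((beta (Real.sqrt 2) / 2) ^ m * bOf a (m + n) * tildeCoef m n)) * C.one := by
  have hO := C.one_pos
  have hβ := beta_sqrt_two_pos
  unfold aLo
  rw [nsum_eq]
  set K := 2 * C.M + 1 - n
  have hterm : ∀ m ∈ range K, ((get2 C.mkTab.wbL n m *
      get ((List.range (2 * C.M + 1)).map (C.bLo C.mkTab lo)) (m + n) : ℕ) : ℝ) ≤
      C.one ^ 2 * ((beta (Real.sqrt 2) / 2) ^ m * bOf a (m + n) * tildeCoef m n) := by
    intro m hm
    have hm' : m < K := by simpa using hm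
    rw [C.mkTab_wbL (by omega) hm', get_map_range _ (by omega)]
    push_cast
    have h1 := C.wbL_sound hs n m
    have h2 := bLo_le hs hE hnn (n := m + n) (by omega)
    calc (C.wbL n m : ℝ) * (C.bLo C.mkTab lo (m + n) : ℕ)
        ≤ (tildeCoef m n * (beta (Real.sqrt 2) / 2) ^ m * C.one) * (bOf a (m + n) * C.one) :=
          mul_le_mul h1 h2 (by positivity) (by have := tildeCoef_nonneg m n; positivity)
      _ = C.one ^ 2 * ((beta (Real.sqrt 2) / 2) ^ m * bOf a (m + n) * tildeCoef m n) := by ring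
  have hS : ((∑ m ∈ range K, get2 C.mkTab.wbL n m *
      get ((List.range (2 * C.M + 1)).map (C.bLo C.mkTab lo)) (m + n) : ℕ) : ℝ) ≤
      C.one ^ 2 * (∑' m, ((beta (Real.sqrt 2) / 2) ^ m * bOf a (m + n) * tildeCoef m n)) := by
    push_cast
    calc ∑ m ∈ range K, ((get2 C.mkTab.wbL n m : ℕ) : ℝ) *
          (get ((List.range (2 * C.M + 1)).map (C.bLo C.mkTab lo)) (m + n) : ℕ)
        ≤ ∑ m ∈ range K, C.one ^ 2 * ((beta (Real.sqrt 2) / 2) ^ m * bOf a (m + n) * tildeCoef m n) :=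
          sum_le_sum fun m hm => by exact_mod_cast hterm m hm
      _ = C.one ^ 2 * ∑ m ∈ range K, ((beta (Real.sqrt 2) / 2) ^ m * bOf a (m + n) * tildeCoef m n) := by rw [mul_sum]
      _ ≤ C.one ^ 2 * (∑' m, ((beta (Real.sqrt 2) / 2) ^ m * bOf a (m + n) * tildeCoef m n)) := by
          apply mul_le_mul_of_nonneg_left _ (by positivity)
          exact hsum.sum_le_tsum (range K) fun m _ => term_nonneg hnn n m
  calc _ ≤ ((∑ m ∈ range K, get2 C.mkTab.wbL n m *
        get ((List.range (2 * C.M + 1)).map (C.bLo C.mkTab lo)) (m + n) : ℕ) : ℝ) / (C.one : ℕ) :=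
        Nat.cast_div_le
    _ ≤ C.one ^ 2 * (∑' m, ((beta (Real.sqrt 2) / 2) ^ m * bOf a (m + n) * tildeCoef m n)) / C.one := div_le_div_of_nonneg_right hS (by positivity)
    _ = (∑' m, ((beta (Real.sqrt 2) / 2) ^ m * bOf a (m + n) * tildeCoef m n)) * C.one := by field_simp

/-- **Upper `T` bound with the tail**: `ã_n 2^P ≤ aHiCore n + tail n`, and the series (5.6)
converges, provided the tail flag holds (`q < 1`). [cite: HaraHattoriWatanabe2001, §5.2 eqs. (5.11), (5.25)–(5.29) and Proposition 5.1] -/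
theorem aT_le_aHi (hs : C.sqrtOK = true) (hM : 1 ≤ C.M) (hE : C.Encl lo hi a) (h0 : a 0 = 1)
    (hnn : ∀ n, 0 ≤ a n) (hA6 : ∀ m n, a (m + n) ≤ a m * a n) {n : ℕ} (hn : n ≤ C.M)
    (hflag : (C.tail C.mkTab (C.powsH (get hi 1) (3 * C.M + 1) C.one) (get hi C.M) (get hi 1) n).2 = true) :
    Summable (fun m => ((beta (Real.sqrt 2) / 2) ^ m * bOf a (m + n) * tildeCoef m n)) ∧
    (∑' m, ((beta (Real.sqrt 2) / 2) ^ m * bOf a (m + n) * tildeCoef m n)) * C.one ≤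
      (C.aHiCore C.mkTab ((List.range (2 * C.M + 1)).map (C.bHi C.mkTab hi)) n : ℝ) +
      (C.tail C.mkTab (C.powsH (get hi 1) (3 * C.M + 1) C.one) (get hi C.M) (get hi 1) n).1 := by
  have hO := C.one_pos
  have hβ := beta_sqrt_two_pos
  have hh : a 1 * C.one ≤ get hi 1 := (hE 1 hM).2
  have hhiM : a C.M * C.one ≤ get hi C.M := (hE C.M le_rfl).2
  -- the checker's ratio data
  set m0 := 2 * C.M + 1 - n with hm0
  set m1 := 3 * C.M + 1 with hm1
  set qn := (if n = 0 then 2 * (m1 + 1) else 2 * m1 + 2 * n + 1) * C.rH * get hi 1 with hqn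
  set qd := (m1 + 1) * 2 * C.one * C.one with hqd
  have hflag' : qn < qd := by
    rw [tail_snd_eq, decide_eq_true_eq] at hflag
    simpa only [← hm1, ← hqn, ← hqd] using hflag
  have hqd_pos : (0 : ℝ) < qd := by rw [hqd]; push_cast; positivity
  set q : ℝ := (qn : ℝ) / qd with hq
  have hq1 : q < 1 := by rw [hq, div_lt_one hqd_pos]; exact_mod_cast hflag'
  have hqle : (if n = 0 then (2 : ℝ) else ((2 * n + 2 * m1 + 1 : ℝ) / (m1 + 1))) * (beta (Real.sqrt 2) * Real.sqrt 2 * a 1 / 2) ≤ q := by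
    have := ratio_le_checker hs hnn hh n m1
    rw [hq, hqn, hqd]; exact this
  obtain ⟨hsum, htail⟩ := summable_and_tail_le h0 hnn hA6 (M := C.M) (n := n) (m0 := m0) (m1 := m1)
    (by omega) (by omega) (by omega) hqle hq1
  refine ⟨hsum, ?_⟩
  -- split the series at m0
  have hsplit := hsum.sum_add_tsum_nat_add m0
  -- the truncated part
  have hcore : (∑ m ∈ range m0, ((beta (Real.sqrt 2) / 2) ^ m * bOf a (m + n) * tildeCoef m n)) * C.one ≤
      (C.aHiCore C.mkTab ((List.range (2 * C.M + 1)).map (C.bHi C.mkTab hi)) n : ℝ) := by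
    unfold aHiCore
    rw [nsum_eq]
    have hterm : ∀ m ∈ range m0, ((beta (Real.sqrt 2) / 2) ^ m * bOf a (m + n) * tildeCoef m n) * C.one ^ 2 ≤ ((get2 C.mkTab.wbH n m *
        get ((List.range (2 * C.M + 1)).map (C.bHi C.mkTab hi)) (m + n) : ℕ) : ℝ) := by
      intro m hm
      have hm' : m < m0 := by simpa using hm
      rw [C.mkTab_wbH (by omega) (by omega), get_map_range _ (by omega)]
      push_cast
      have h1 := C.wbH_sound hs n m
      have h2 := le_bHi hs hE hnn hA6 (n := m + n) (by omega)
      calc ((beta (Real.sqrt 2) / 2) ^ m * bOf a (m + n) * tildeCoef m n) * C.one ^ 2 =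
            (tildeCoef m n * (beta (Real.sqrt 2) / 2) ^ m * C.one) * (bOf a (m + n) * C.one) := by ring
        _ ≤ (C.wbH n m : ℝ) * (C.bHi C.mkTab hi (m + n) : ℕ) :=
            mul_le_mul h1 h2 (mul_nonneg (bOf_nonneg_of_nonneg hnn _) hO.le) (by positivity)
    have hS : (∑ m ∈ range m0, ((beta (Real.sqrt 2) / 2) ^ m * bOf a (m + n) * tildeCoef m n)) * C.one ^ 2 ≤ ((∑ m ∈ range m0, get2 C.mkTab.wbH n m *
        get ((List.range (2 * C.M + 1)).map (C.bHi C.mkTab hi)) (m + n) : ℕ) : ℝ) := by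
      rw [sum_mul]; push_cast
      exact sum_le_sum fun m hm => by exact_mod_cast hterm m hm
    calc (∑ m ∈ range m0, ((beta (Real.sqrt 2) / 2) ^ m * bOf a (m + n) * tildeCoef m n)) * C.one =
          (∑ m ∈ range m0, ((beta (Real.sqrt 2) / 2) ^ m * bOf a (m + n) * tildeCoef m n)) * C.one ^ 2 / C.one := by
          field_simp
      _ ≤ ((∑ m ∈ range m0, get2 C.mkTab.wbH n m *
          get ((List.range (2 * C.M + 1)).map (C.bHi C.mkTab hi)) (m + n) : ℕ) : ℝ) / (C.one : ℕ) :=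
          div_le_div_of_nonneg_right hS (by positivity)
      _ ≤ _ := div_le_cdiv _ C.one_pos_nat
  -- the tail part
  have htailN : (∑' j, ((beta (Real.sqrt 2) / 2) ^ (j + m0) * bOf a (j + m0 + n) * tildeCoef (j + m0) n)) * C.one ≤
      (C.tail C.mkTab (C.powsH (get hi 1) (3 * C.M + 1) C.one) (get hi C.M) (get hi 1) n).1 := by
    have e : (fun j => ((beta (Real.sqrt 2) / 2) ^ (j + m0) * bOf a (j + m0 + n) * tildeCoef (j + m0) n)) = fun j => ((beta (Real.sqrt 2) / 2) ^ (m0 + j) * bOf a (m0 + j + n) * tildeCoef (m0 + j) n) := by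
      funext j; rw [add_comm]
    rw [e, tail_fst_eq]
    simp only [← hm0, ← hm1, ← hqn, ← hqd]
    rw [nsum_eq]
    push_cast
    -- explicit terms
    have hexp : (∑ j ∈ range (m1 - m0), (tildeCoef (m0 + j) n * (beta (Real.sqrt 2) / 2) ^ (m0 + j) * (Real.sqrt 2 / 2) ^ (m0 + j + n) * (a C.M * a 1 ^ (m0 + j + n - C.M)))) * C.one ≤
        ∑ j ∈ range (m1 - m0), ((C.termU C.mkTab (C.powsH (get hi 1) (3 * C.M + 1) C.one)
          (get hi C.M) n (m0 + j) : ℕ) : ℝ) := by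
      rw [sum_mul]
      refine sum_le_sum fun j hj => ?_
      have hj' : j < m1 - m0 := by simpa using hj
      exact U_le_termU hs hnn hh hhiM hn (by omega) (by omega)
    -- geometric remainder
    have hlast := U_le_termU hs hnn hh hhiM hn (m := m1) (by omega) le_rfl
    have hsub : (((qd - qn : ℕ) : ℝ)) = (qd : ℝ) - qn := by push_cast [Nat.cast_sub hflag'.le]; ring
    have hgeo : (tildeCoef m1 n * (beta (Real.sqrt 2) / 2) ^ m1 * (Real.sqrt 2 / 2) ^ (m1 + n) * (a C.M * a 1 ^ (m1 + n - C.M))) / (1 - q) * C.one ≤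
        (cdiv (C.termU C.mkTab (C.powsH (get hi 1) (3 * C.M + 1) C.one) (get hi C.M) n m1 * qd)
          (qd - qn) : ℕ) := by
      have hlt : (qn : ℝ) < qd := by exact_mod_cast hflag'
      have hpos : (0 : ℝ) < qd - qn := by linarith
      have e1 : 1 - q = ((qd : ℝ) - qn) / qd := by rw [hq]; field_simp
      calc (tildeCoef m1 n * (beta (Real.sqrt 2) / 2) ^ m1 * (Real.sqrt 2 / 2) ^ (m1 + n) * (a C.M * a 1 ^ (m1 + n - C.M))) / (1 - q) * C.one =
            ((tildeCoef m1 n * (beta (Real.sqrt 2) / 2) ^ m1 * (Real.sqrt 2 / 2) ^ (m1 + n) * (a C.M * a 1 ^ (m1 + n - C.M))) * C.one) * qd / ((qd : ℝ) - qn) := by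
            rw [e1]; field_simp
        _ ≤ (C.termU C.mkTab (C.powsH (get hi 1) (3 * C.M + 1) C.one) (get hi C.M) n m1 : ℝ) * qd /
              ((qd : ℝ) - qn) := by
            apply div_le_div_of_nonneg_right _ hpos.le
            exact mul_le_mul_of_nonneg_right hlast (by positivity)
        _ = ((C.termU C.mkTab (C.powsH (get hi 1) (3 * C.M + 1) C.one) (get hi C.M) n m1 * qd : ℕ) : ℝ) /
              ((qd - qn : ℕ) : ℝ) := by rw [hsub]; push_cast; ring
        _ ≤ _ := div_le_cdiv _ (by omega)
    calc (∑' j, ((beta (Real.sqrt 2) / 2) ^ (m0 + j) * bOf a (m0 + j + n) * tildeCoef (m0 + j) n)) * C.one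
        ≤ (∑ j ∈ range (m1 - m0), (tildeCoef (m0 + j) n * (beta (Real.sqrt 2) / 2) ^ (m0 + j) * (Real.sqrt 2 / 2) ^ (m0 + j + n) * (a C.M * a 1 ^ (m0 + j + n - C.M))) +
            (tildeCoef m1 n * (beta (Real.sqrt 2) / 2) ^ m1 * (Real.sqrt 2 / 2) ^ (m1 + n) * (a C.M * a 1 ^ (m1 + n - C.M))) / (1 - q)) * C.one :=
          mul_le_mul_of_nonneg_right htail hO.le
      _ = (∑ j ∈ range (m1 - m0), (tildeCoef (m0 + j) n * (beta (Real.sqrt 2) / 2) ^ (m0 + j) * (Real.sqrt 2 / 2) ^ (m0 + j + n) * (a C.M * a 1 ^ (m0 + j + n - C.M)))) * C.one +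
            (tildeCoef m1 n * (beta (Real.sqrt 2) / 2) ^ m1 * (Real.sqrt 2 / 2) ^ (m1 + n) * (a C.M * a 1 ^ (m1 + n - C.M))) / (1 - q) * C.one := by ring
      _ ≤ _ := add_le_add hexp hgeo
  calc (∑' m, ((beta (Real.sqrt 2) / 2) ^ m * bOf a (m + n) * tildeCoef m n)) * C.one =
        (∑ m ∈ range m0, ((beta (Real.sqrt 2) / 2) ^ m * bOf a (m + n) * tildeCoef m n) + ∑' j, ((beta (Real.sqrt 2) / 2) ^ (j + m0) * bOf a (j + m0 + n) * tildeCoef (j + m0) n)) * C.one := by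
        rw [hsplit]
    _ = (∑ m ∈ range m0, ((beta (Real.sqrt 2) / 2) ^ m * bOf a (m + n) * tildeCoef m n)) * C.one + (∑' j, ((beta (Real.sqrt 2) / 2) ^ (j + m0) * bOf a (j + m0 + n) * tildeCoef (j + m0) n)) * C.one := by
        ring
    _ ≤ _ := add_le_add hcore htailN


variable (C) in
/-- `step`, first component. [folklore] -/
theorem step_fst (T : Tab) (st : State) : (C.step T st).1 =
    C.one :: (List.range C.M).map fun j => get (C.aloL T st.1) (j + 1) * C.one / get (C.ahiL T st.2.1) 0 :=
  rfl

variable (C) in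
/-- `step`, second component. [folklore] -/
theorem step_snd (T : Tab) (st : State) : (C.step T st).2.1 =
    C.one :: (List.range C.M).map fun j => cdiv (get (C.ahiL T st.2.1) (j + 1) * C.one) (get (C.aloL T st.1) 0) :=
  rfl

variable (C) in
/-- `step`, flag. [folklore] -/
theorem step_flag (T : Tab) (st : State) : (C.step T st).2.2 =
    (st.2.2 && (C.tlL T st.2.1).all (fun t => t.2) && decide (0 < get (C.aloL T st.1) 0)) :=
  rfl

/-- Reading `aloL`. [folklore] -/
theorem get_aloL (T : Tab) (lo : List ℕ) {n : ℕ} (hn : n < C.M + 1) :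
    get (C.aloL T lo) n = C.aLo T (C.bloL T lo) n := get_map_range _ hn

/-- Reading `ahiL`. [folklore] -/
theorem get_ahiL (T : Tab) (hi : List ℕ) {n : ℕ} (hn : n < C.M + 1) :
    get (C.ahiL T hi) n = C.aHiCore T (C.bhiL T hi) n + (C.tail T (C.hpL hi) (get hi C.M) (get hi 1) n).1 := by
  unfold ahiL
  rw [get_map_range _ hn]
  unfold tlL
  rw [getD_map_range _ _ hn]

/-- The flags of a successful step. [folklore] -/
theorem step_flag_sound {T : Tab} {st : State} (h : (C.step T st).2.2 = true) :
    st.2.2 = true ∧ (∀ n, n < C.M + 1 → (C.tail T (C.hpL st.2.1) (get st.2.1 C.M) (get st.2.1 1) n).2 = true) ∧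
      0 < get (C.aloL T st.1) 0 := by
  rw [step_flag] at h
  simp only [Bool.and_eq_true, List.all_eq_true, decide_eq_true_eq] at h
  obtain ⟨⟨h1, h2⟩, h3⟩ := h
  refine ⟨h1, fun n hn => h2 _ ?_, h3⟩
  unfold tlL
  exact List.mem_map.2 ⟨n, List.mem_range.2 hn, rfl⟩

variable {a' : ℕ → ℝ}

/-- **Soundness of one step (Proposition 5.1, induction step).** If `(lo, hi)` encloses a Newman
sequence `a`, the next sequence is `a'_n = ã_n/ã_0`, and the step's flag holds, then the new state
encloses `a'`. [cite: HaraHattoriWatanabe2001, Proposition 5.1] -/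
theorem step_sound (hs : C.sqrtOK = true) (hM : 1 ≤ C.M) {st : State} (hE : C.Encl st.1 st.2.1 a)
    (h0 : a 0 = 1) (hnn : ∀ n, 0 ≤ a n) (hA6 : ∀ m n, a (m + n) ≤ a m * a n)
    (hrec : ∀ n, n ≤ C.M → a' n = (∑' m, ((beta (Real.sqrt 2) / 2) ^ m * bOf a (m + n) * tildeCoef m n)) /
      (∑' m, ((beta (Real.sqrt 2) / 2) ^ m * bOf a (m + 0) * tildeCoef m 0)))
    (hflag : (C.step C.mkTab st).2.2 = true) :
    C.Encl (C.step C.mkTab st).1 (C.step C.mkTab st).2.1 a' := by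
  have hO := C.one_pos
  obtain ⟨-, htl, h0pos⟩ := step_flag_sound hflag
  set T := C.mkTab
  set lo := st.1
  set hi := st.2.1
  -- bounds on ã
  have hT : ∀ n, n ≤ C.M → (get (C.aloL T lo) n : ℝ) ≤ (∑' m, ((beta (Real.sqrt 2) / 2) ^ m * bOf a (m + n) * tildeCoef m n)) * C.one ∧
      (∑' m, ((beta (Real.sqrt 2) / 2) ^ m * bOf a (m + n) * tildeCoef m n)) * C.one ≤ (get (C.ahiL T hi) n : ℝ) := by
    intro n hn
    obtain ⟨hsum, hup⟩ := aT_le_aHi hs hM hE h0 hnn hA6 hn (htl n (by omega))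
    refine ⟨?_, ?_⟩
    · rw [get_aloL _ _ (by omega)]; exact aLo_le hs hE hnn hn hsum
    · rw [get_ahiL _ _ (by omega)]; push_cast; exact hup
  have hA0 : 0 < ∑' m, ((beta (Real.sqrt 2) / 2) ^ m * bOf a (m + 0) * tildeCoef m 0) := by
    have h1 := (hT 0 (Nat.zero_le _)).1
    have h2 : (0 : ℝ) < get (C.aloL T lo) 0 := by exact_mod_cast h0pos
    nlinarith
  intro n hn
  rcases n with _ | j
  · rw [step_fst, step_snd, hrec 0 (Nat.zero_le _), div_self hA0.ne']
    simp
  · rw [step_fst, step_snd, get_cons_succ, get_cons_succ, get_map_range _ (by omega),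
      get_map_range _ (by omega), hrec (j + 1) hn]
    obtain ⟨hlo0, hhi0⟩ := hT 0 (Nat.zero_le _)
    obtain ⟨hlon, hhin⟩ := hT (j + 1) hn
    have hAn : 0 ≤ ∑' m, ((beta (Real.sqrt 2) / 2) ^ m * bOf a (m + (j + 1)) * tildeCoef m (j + 1)) := tsum_nonneg fun m => term_nonneg hnn _ _
    have h0posR : (0 : ℝ) < get (C.aloL T lo) 0 := by exact_mod_cast h0pos
    constructor
    · calc ((get (C.aloL T lo) (j + 1) * C.one / get (C.ahiL T hi) 0 : ℕ) : ℝ)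
          ≤ (get (C.aloL T lo) (j + 1) : ℝ) * C.one / get (C.ahiL T hi) 0 := by
            have := Nat.cast_div_le (α := ℝ) (m := get (C.aloL T lo) (j + 1) * C.one)
              (n := get (C.ahiL T hi) 0)
            push_cast at this; exact this
        _ ≤ ((∑' m, ((beta (Real.sqrt 2) / 2) ^ m * bOf a (m + (j + 1)) * tildeCoef m (j + 1))) * C.one) * C.one /
              ((∑' m, ((beta (Real.sqrt 2) / 2) ^ m * bOf a (m + 0) * tildeCoef m 0)) * C.one) := by
            have hpos : 0 < (∑' m, ((beta (Real.sqrt 2) / 2) ^ m * bOf a (m + 0) * tildeCoef m 0)) * C.one := by positivity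
            calc (get (C.aloL T lo) (j + 1) : ℝ) * C.one / get (C.ahiL T hi) 0
                ≤ (get (C.aloL T lo) (j + 1) : ℝ) * C.one / ((∑' m, ((beta (Real.sqrt 2) / 2) ^ m * bOf a (m + 0) * tildeCoef m 0)) * C.one) :=
                  div_le_div_of_nonneg_left (by positivity) hpos hhi0
              _ ≤ _ := by
                  apply div_le_div_of_nonneg_right _ hpos.le
                  exact mul_le_mul_of_nonneg_right hlon hO.le
        _ = _ := by field_simp
    · calc (∑' m, ((beta (Real.sqrt 2) / 2) ^ m * bOf a (m + (j + 1)) * tildeCoef m (j + 1))) / (∑' m, ((beta (Real.sqrt 2) / 2) ^ m * bOf a (m + 0) * tildeCoef m 0)) * C.one =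
            ((∑' m, ((beta (Real.sqrt 2) / 2) ^ m * bOf a (m + (j + 1)) * tildeCoef m (j + 1))) * C.one) * C.one / ((∑' m, ((beta (Real.sqrt 2) / 2) ^ m * bOf a (m + 0) * tildeCoef m 0)) * C.one) := by
            field_simp
        _ ≤ (get (C.ahiL T hi) (j + 1) : ℝ) * C.one / ((∑' m, ((beta (Real.sqrt 2) / 2) ^ m * bOf a (m + 0) * tildeCoef m 0)) * C.one) := by
            apply div_le_div_of_nonneg_right _ (by positivity)
            exact mul_le_mul_of_nonneg_right hhin hO.le
        _ ≤ (get (C.ahiL T hi) (j + 1) : ℝ) * C.one / get (C.aloL T lo) 0 :=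
            div_le_div_of_nonneg_left (by positivity) h0posR hlo0
        _ = ((get (C.ahiL T hi) (j + 1) * C.one : ℕ) : ℝ) / (get (C.aloL T lo) 0 : ℕ) := by push_cast; ring
        _ ≤ _ := div_le_cdiv _ h0pos

end Cfg

end Literature.Barriers.CriticalPhenomena.HierarchicalRG.Thm22Cert

end
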